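import Summits.AtomisticToContinuum.HydrodynamicLimit.Theorems.StiffCollisionalRelaxationAprioriBoundsEquilibriumStatics
import Summits.AtomisticToContinuum.HydrodynamicLimit.Theorems.StiffCollisionalRelaxationAprioriBoundsEquilibriumPartOne
import HarnessLib

/-!
# The open stub `velocityLLN` at homogeneous data: fixed-time LLN for bounded velocity statistics, every flow

Supporting file of the line `Sketch` for the crux `AprioriBounds` (stmt-AtomisticToContinuum-14827), lead prover
`prover-line-stmt-AtomisticToContinuum-14827-c4-0`.  The registered OPEN stub `stub_velocityLLN` (reshape r7) asks,
under the crux prefix, that at each fixed time `s ∈ [0, t]` every bounded continuous VELOCITY statistic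
`∫ ψ(v) d(empirical measure of Φ_s z) = (N+1)⁻¹∑ᵢ ψ(vᵢ(s))` converges in `P_N`-probability to SOME deterministic
constant `m`: `P_N{δ < |(N+1)⁻¹∑ᵢ ψ(vᵢ(s)) − m|} → 0` for every `δ > 0`.  This file PROVES that stub VERBATIM at
the homogeneous profiles `(a₀, θ₀, u₀) = (1, θ₀, 0)` (`velocityLLN_homogeneous`), for EVERY family of hard-sphere
flows, with the explicit witness `m = E_{N(0,θ₀)} ψ` — the crux prefix (classical solution, `t = 0` LLN, horizon,
chamber) is then idle (`σ₀ = 1/2`, `η₁ = 1`).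

Proof: invariance of the homogeneous law under every flow (`measurePreserving_flow_localGibbsMeasure_homogeneous`)
moves the time-`s` event to time `0`; there positions and velocities are independent and the velocities i.i.d.
`N(0, θ₀)` (`localGibbsMeasure_rung0_eq_map`), so Bienaymé–Chebyshev on the velocity product
(`pi_measure_avg_ge_le`) gives `P_N{δ ≤ |(N+1)⁻¹∑ᵢ ψ(vᵢ) − m|} ≤ Var_{N(0,θ₀)}(ψ)/((N+1)δ²) → 0`
(`localGibbsMeasure_velAvg_dev_le`; `ψ` bounded, hence in `L²` of the Maxwellian).

No new definitions, no named facts; axioms `propext`, `Classical.choice`, `Quot.sound`.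
-/

noncomputable section

open MeasureTheory ProbabilityTheory Filter Set Topology
open scoped ENNReal

namespace Summit.AtomisticToContinuum.HydrodynamicLimit.Theorems.AdiabatCeiling

open Literature.MathematicalPhysics.KineticTheory Literature.Analysis.FluidPDE

/-- **Static Chebyshev bound under the homogeneous local Gibbs law.**  For `σ ≤ 1/2`, `θ₀ > 0`, a measurable
`ψ ∈ L²(N(0, θ₀))`, every `N` and every `δ > 0`:
`P_N{δ ≤ |(N+1)⁻¹∑ᵢ ψ(vᵢ) − E_{N(0,θ₀)}ψ|} ≤ Var_{N(0,θ₀)}(ψ) / ((N+1)δ²)` — under `P_N` the velocities are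
i.i.d. `N(0, θ₀)` and independent of the positions (`localGibbsMeasure_rung0_eq_map`), so this is
Bienaymé–Chebyshev on the velocity product (`pi_measure_avg_ge_le`). -/
theorem localGibbsMeasure_velAvg_dev_le {σ θ₀ : ℝ} (hσ2 : σ ≤ 1 / 2) (hθ : 0 < θ₀) {ψ : V3 → ℝ}
    (hψm : Measurable ψ) (hψ2 : MemLp ψ 2 (gaussMeasure (0 : V3) θ₀)) (N : ℕ) {δ : ℝ} (hδ : 0 < δ) :
    localGibbsMeasure σ (fun _ => 1) (fun _ => 0) (fun _ => θ₀) N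
        {z | δ ≤ |((N + 1 : ℕ) : ℝ)⁻¹ * ∑ i, ψ (z i).2 - ∫ v, ψ v ∂gaussMeasure (0 : V3) θ₀|} ≤
      ENNReal.ofReal (Var[ψ; gaussMeasure (0 : V3) θ₀] / ((N + 1 : ℕ) * δ ^ 2)) := by
  set γ : Measure V3 := gaussMeasure (0 : V3) θ₀ with hγ
  set m : ℝ := ∫ v, ψ v ∂γ with hm
  haveI : IsProbabilityMeasure (posGibbsMeasure (fun _ : T3 => (1 : ℝ)) (hsDiameter σ N) (N + 1)) :=
    isProbabilityMeasure_posGibbsMeasure continuous_const (fun _ => one_pos) hσ2 N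
  have hSm : MeasurableSet {z : Config (N + 1) (Fin 3) T3 |
      δ ≤ |((N + 1 : ℕ) : ℝ)⁻¹ * ∑ i, ψ (z i).2 - m|} :=
    measurableSet_le measurable_const ((measurable_const.mul (Finset.measurable_sum _ fun i _ =>
      hψm.comp (measurable_pi_apply i).snd)).sub_const m).abs
  -- the event depends on the velocities only
  set T : Set (Fin (N + 1) → V3) := {v | δ ≤ |((N + 1 : ℕ) : ℝ)⁻¹ * ∑ i, ψ (v i) - m|} with hT
  have hpre : zipConfig ⁻¹' {z : Config (N + 1) (Fin 3) T3 |
      δ ≤ |((N + 1 : ℕ) : ℝ)⁻¹ * ∑ i, ψ (z i).2 - m|} = (univ : Set (Fin (N + 1) → T3)) ×ˢ T := by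
    ext p
    simp [hT, zipConfig_apply]
  rw [localGibbsMeasure_rung0_eq_map σ zero_le_one hθ 0 N, Measure.map_apply measurable_zipConfig hSm,
    hpre, Measure.prod_prod, measure_univ, one_mul]
  -- centre the summands: `n⁻¹ ∑ ψᵢ − m = n⁻¹ ∑ (ψᵢ − m)`, then Bienaymé–Chebyshev on the product
  have hcentre : ∀ v : Fin (N + 1) → V3,
      ((N + 1 : ℕ) : ℝ)⁻¹ * ∑ i, ψ (v i) - m = ((N + 1 : ℕ) : ℝ)⁻¹ * ∑ i, (ψ (v i) - m) := by
    intro v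
    rw [Finset.sum_sub_distrib, Finset.sum_const, Finset.card_univ, Fintype.card_fin,
      nsmul_eq_mul, mul_sub, ← mul_assoc ((N + 1 : ℕ) : ℝ)⁻¹, inv_mul_cancel₀ (by positivity), one_mul]
  have hTeq : T = {v | δ ≤ |((N + 1 : ℕ) : ℝ)⁻¹ * ∑ i, (ψ (v i) - m)|} := by
    ext v
    rw [hT, mem_setOf_eq, mem_setOf_eq, hcentre]
  have hX2 : MemLp (fun v : V3 => ψ v - m) 2 γ := hψ2.sub (memLp_const m)
  have hX0 : ∫ v, (ψ v - m) ∂γ = 0 := by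
    rw [integral_sub (hψ2.integrable one_le_two) (integrable_const m), hm]
    simp [hγ]
  have hvar : Var[fun v : V3 => ψ v - m; γ] = Var[ψ; γ] :=
    variance_sub_const hψ2.aestronglyMeasurable m
  have h := pi_measure_avg_ge_le (fun _ : Fin (N + 1) => γ) (fun _ v => ψ v - m) (fun _ => hX2)
    (fun _ => hX0) (B := Var[ψ; γ]) (fun _ => hvar.le) hδ
  rw [Fintype.card_fin] at h
  rw [hTeq]
  exact h

/-- **`stub_velocityLLN` AT HOMOGENEOUS DATA, for every flow.**  At the profiles `(1, θ₀, 0)`, `θ₀ > 0`: for all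
`0 < σ < 1/2`, every family of hard-sphere flows `Φ`, every `t > 0` (the rest of the crux prefix being idle), every
bounded continuous velocity statistic `ψ` and every fixed time `s ∈ [0, t]`, the empirical average
`∫ ψ(v) d(empirical measure of Φ_s z) = (N+1)⁻¹∑ᵢ ψ(vᵢ(s))` converges in `P_N`-probability to
`m = E_{N(0,θ₀)} ψ`: flow invariance of the homogeneous law moves the event to time `0`
(`measurePreserving_flow_localGibbsMeasure_homogeneous`), where `localGibbsMeasure_velAvg_dev_le` bounds it by
`Var(ψ)/((N+1)δ²) → 0`. -/
theorem velocityLLN_homogeneous :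
    ∀ θ₀ : ℝ, 0 < θ₀ → ∃ σ₀ : ℝ, 0 < σ₀ ∧ ∃ η₁ : ℝ, 0 < η₁ ∧ ∀ σ : ℝ, 0 < σ → σ < σ₀ →
      ∀ (T : ℝ) (ρ θ : ℝ → T3 → ℝ) (u : ℝ → T3 → V3), IsHardSphereEulerSolution σ T ρ u θ →
      ∀ Φ : (N : ℕ) → HardSphereFlow (Torus.geometry (Fin 3)) (hsDiameter σ N) (N + 1),
        TendstoHydroFieldsAt
            (fun N => localGibbsLaw σ (fun _ => 1) (fun _ => 0) (fun _ => θ₀) N (Φ N)) Φ ρ u θ 0 →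
        ∀ t : ℝ, 0 < t → t < T → (∀ s ∈ Icc 0 t, ∀ x, 2 * ρ s x * σ ^ 3 < η₁) →
          ∀ ψ : V3 → ℝ, Continuous ψ → (∃ B : ℝ, ∀ v, |ψ v| ≤ B) → ∀ s ∈ Icc 0 t, ∃ m : ℝ,
            ∀ δ : ℝ, 0 < δ → Tendsto (fun N : ℕ =>
              localGibbsLaw σ (fun _ => 1) (fun _ => 0) (fun _ => θ₀) N (Φ N)
                {z | δ < |(∫ y, ψ y.2 ∂(empiricalMeasure ((Φ N).flow s z))) - m|}) atTop (𝓝 0) := by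
  intro θ₀ hθ
  refine ⟨1 / 2, one_half_pos, 1, one_pos,
    fun σ _hσ hσlt _T _ρ _θ _u _ Φ _ t _ht _ _ ψ hψ hB s _hs => ?_⟩
  have hσ2 : σ ≤ 1 / 2 := hσlt.le
  obtain ⟨B, hB⟩ := hB
  set γ : Measure V3 := gaussMeasure (0 : V3) θ₀ with hγ
  set m : ℝ := ∫ v, ψ v ∂γ with hm
  have hψm : Measurable ψ := hψ.measurable
  have hψ2 : MemLp ψ 2 γ :=
    MemLp.of_bound hψm.aestronglyMeasurable B
      (ae_of_all _ fun v => by rw [Real.norm_eq_abs]; exact hB v)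
  set Vr : ℝ := Var[ψ; γ] with hVr
  refine ⟨m, fun δ hδ => ?_⟩
  -- the bound at every `N`: invariance moves time `s` to time `0`, then the static Chebyshev bound
  have hbound : ∀ N : ℕ, localGibbsLaw σ (fun _ => 1) (fun _ => 0) (fun _ => θ₀) N (Φ N)
      {z | δ < |(∫ y, ψ y.2 ∂(empiricalMeasure ((Φ N).flow s z))) - m|} ≤
      ENNReal.ofReal (Vr / ((N + 1 : ℕ) * δ ^ 2)) := by
    intro N
    rw [localGibbsLaw_eq]
    set P : Measure (Config (N + 1) (Fin 3) T3) :=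
      localGibbsMeasure σ (fun _ => 1) (fun _ => 0) (fun _ => θ₀) N with hP
    set F : Config (N + 1) (Fin 3) T3 → ℝ := fun z => ((N + 1 : ℕ) : ℝ)⁻¹ * ∑ i, ψ (z i).2 with hF
    have hFm : Measurable F :=
      measurable_const.mul (Finset.measurable_sum _ fun i _ => hψm.comp (measurable_pi_apply i).snd)
    have hFemp : ∀ w : Config (N + 1) (Fin 3) T3, ∫ y, ψ y.2 ∂(empiricalMeasure w) = F w := fun w => by
      simp only [hF, integral_empiricalMeasure]
    simp_rw [hFemp]
    have hSm : MeasurableSet {z | δ < |F z - m|} := measurableSet_lt measurable_const (hFm.sub_const m).abs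
    have hinv := measurePreserving_flow_localGibbsMeasure_homogeneous σ θ₀ N (Φ N) s
    have hpre : {z | δ < |F ((Φ N).flow s z) - m|} = (Φ N).flow s ⁻¹' {z | δ < |F z - m|} := rfl
    rw [hpre, hinv.measure_preimage hSm.nullMeasurableSet]
    calc P {z | δ < |F z - m|} ≤ P {z | δ ≤ |F z - m|} :=
          measure_mono fun z (hz : δ < |F z - m|) => show δ ≤ |F z - m| from hz.le
      _ ≤ ENNReal.ofReal (Vr / ((N + 1 : ℕ) * δ ^ 2)) :=
          localGibbsMeasure_velAvg_dev_le hσ2 hθ hψm hψ2 N hδ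
  -- the bound tends to zero
  have hlim : Tendsto (fun N : ℕ => ENNReal.ofReal (Vr / ((N + 1 : ℕ) * δ ^ 2))) atTop (𝓝 0) := by
    rw [← ENNReal.ofReal_zero]
    refine ENNReal.tendsto_ofReal ?_
    have h := (tendsto_const_div_atTop_nhds_zero_nat (Vr / δ ^ 2)).comp (tendsto_add_atTop_nat 1)
    refine h.congr fun N => ?_
    simp only [Function.comp_apply]
    rw [div_div, mul_comm]
  exact tendsto_of_tendsto_of_tendsto_of_le_of_le tendsto_const_nhds hlim (fun _ => zero_le) hbound

end Summit.AtomisticToContinuum.HydrodynamicLimit.Theorems.AdiabatCeiling
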